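import Summits.QuantumFields.BalabanUV.T4Continuum.Support.NE7K1LinBlochSymbol
import Literature.MathematicalPhysics.QuantumFieldTheory.Balaban1983to89.T4GaugeActionRateStrip

/-!
# NE7K1LinBlochSymbolSeam — row NE7 (node U5), candidate route HOM, path H1L, cell K1-lin(s): NEEDS-ESTIMATE #E1, B-E1 TYPED —
# THE `2π` LAW OF `k_L` IN A COMPLEX NEIGHBOURHOOD OF THE STRIP FACES (not only ON them): for `|Im p_ν| ≤ κ` (`dκ² ≤ 1∕16`) and
# `−π − 1∕4 ≤ Re p_μ ≤ −π + 1∕4`, `k_L(p + 2πe_μ) = k_L(p)` — all four side conditions of file 48's `kL_tr` discharged near the faces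
# (`Re Δ^ξ_L > 0` there, every `L ≥ 1`) — the seam lemma a folded (manifestly periodic) multiplier `k_L ∘ fold` or the class-S
# re-typing (R-E1) needs to pass alias-shifted momenta `p + 2πk` back into the strip

Lineage `b2b-balaban-t4-ne7-p2` (CRUX PROVER NE7 #2), generation 74; file 54.  File 48's `kL_tr` gives `k_L(p + 2πe_μ) = k_L(p)` under
`p_μ ∉ {0, −2π}` and `Δ^ξ_L ≠ 0` at `p` and `p + 2πe_μ`, and `kL_periodic_side` discharges them ON the faces `Re p_μ = −π` of the strip.
The typed quotient `kL = Δ^ξ_L ∕ 𝓝_L` is the true multiplier only where no alias denominator vanishes (off the fat region, at the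
`2π`-translates of the complex zeros of `Δ^ξ_L`, the true `𝓝_L` has a pole and the typed quotient a junk value), so a consumer that meets
`k_L` at alias-shifted momenta must FOLD them back into the strip; holomorphy across the folding seams needs the `2π` law in a
NEIGHBOURHOOD of the faces.  THIS FILE supplies it ([folklore]):

* the near-face positivity `Re Δ^ξ_L(q) > 0` (all `|Im q_ν| ≤ κ ≤ 1`, `dκ² ≤ 1∕16`, ONE coordinate with `π − 1∕4 ≤ |Re q_μ| ≤ π + 1∕4`,
  the other real parts ARBITRARY) is the tree's `T4GaugeActionRateStrip.re_DeltaXi_pos_near_side` (with `three_le_scaled_sin_sq`),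
  used BY NAME (a preflight dedup located it);
* **`kL_tr_near_face`**: for such `q` with `−π − 1∕4 ≤ Re q_μ ≤ −π + 1∕4`: `k_L(q + 2πe_μ) = k_L(q)`; and **`kL_sub_two_pi_near_face`**:
  for `π − 1∕4 ≤ Re q_μ ≤ π + 1∕4`, `k_L(q − 2πe_μ) = k_L(q)` — the two seams of a fold into `[−π, π)`.

HONEST FRAMING: [folklore]; the tree's near-side positivity + file 48's algebraic shift law; the folded multiplier itself and its
holomorphy on the periodised strip are NOT typed here (S, for R-E1's typist: off the seams `fold` is locally a constant translation,
on them this file's two lemmas reconcile the two representatives); R-E1 untouched; nothing of Bałaban's asserted; no `sorry`.  Census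
only; NE7 NOT PRINTED ∕ NOT PROVED; spine 0∕9; FIXED FINITE T⁴, rung (B)+1; NOT infinite volume, NOT mass gap, NOT Clay.  HONEST
DEPENDENCY: continuum YM on T⁴ ⇐ BetaPertH ∧ nine spine estimates (0/9 proved); BetaPertH ⇐ (D1) ∧ (D4) ∧ CAP+tail; G-an2-4 gates
asym, D1 and NE2/3/4.
-/

noncomputable section

open Finset Complex Set

namespace Summit.QuantumFields.BalabanUV.T4Continuum.NE7K1LinBlochSymbolSeam

open Literature.MathematicalPhysics.QuantumFieldTheory.Balaban1983to89
open Literature.MathematicalPhysics.QuantumFieldTheory.Balaban1983to89.B4Strip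
open Literature.MathematicalPhysics.QuantumFieldTheory.Balaban1983to89.B4StripCauchy
open Literature.MathematicalPhysics.QuantumFieldTheory.Balaban1983to89.B5Strip145Analytic
open Literature.MathematicalPhysics.QuantumFieldTheory.Balaban1983to89.T4GaugeActionRateStrip (re_DeltaXi_pos_near_side)
open NE7K1LinBlochDenominator NE7K1LinBlochSymbol

variable {d : ℕ}

/-! ### The `2π` law near the faces -/

/-- **THE `2π` LAW NEAR THE LEFT FACE**: for `q` with all `|Im q_ν| ≤ κ` (`κ ≤ 1`, `dκ² ≤ 1∕16`) and `−π − 1∕4 ≤ Re q_μ ≤ −π + 1∕4`: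
`k_L(q + 2πe_μ) = k_L(q)`, every `L ≥ 1` — file 48's `kL_tr` with its four side conditions discharged in a NEIGHBOURHOOD of the face
(`q_μ ≠ 0`, `q_μ + 2π ≠ 0` by the real parts; `Δ^ξ_L ≠ 0` at both points by `T4GaugeActionRateStrip.re_DeltaXi_pos_near_side`).
[folklore] -/
theorem kL_tr_near_face (L : ℕ) [NeZero L] {κ : ℝ} (hκ : κ ≤ 1) (hdκ : (d : ℝ) * κ ^ 2 ≤ 1 / 16)
    {q : Fin d → ℂ} (hIm : ∀ ν, |(q ν).im| ≤ κ) (μ : Fin d)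
    (h1 : -Real.pi - 1 / 4 ≤ (q μ).re) (h2 : (q μ).re ≤ -Real.pi + 1 / 4) : kL L (tr q μ) = kL L q := by
  have hπ := Real.pi_gt_three
  have hz : q μ ≠ 0 := by
    intro h; rw [h, Complex.zero_re] at h2; linarith
  have hz' : q μ + 2 * Real.pi ≠ 0 := by
    intro h
    have := congrArg Complex.re h
    rw [← tr_apply_self, tr_re_self, Complex.zero_re] at this
    linarith
  have habs : Real.pi - 1 / 4 ≤ |(q μ).re| ∧ |(q μ).re| ≤ Real.pi + 1 / 4 := by
    rw [abs_of_neg (by linarith)]; exact ⟨by linarith, by linarith⟩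
  have h0 : DeltaXi L 0 q ≠ 0 := by
    intro h
    have := re_DeltaXi_pos_near_side L hκ hdκ hIm μ habs.1 habs.2
    rw [h, Complex.zero_re] at this
    linarith
  have habs' : Real.pi - 1 / 4 ≤ |(tr q μ μ).re| ∧ |(tr q μ μ).re| ≤ Real.pi + 1 / 4 := by
    rw [tr_re_self, abs_of_pos (by linarith)]; exact ⟨by linarith, by linarith⟩
  have h1' : DeltaXi L 0 (tr q μ) ≠ 0 := by
    intro h
    have := re_DeltaXi_pos_near_side L hκ hdκ (q := tr q μ) (fun ν => by rw [tr_im]; exact hIm ν) μ habs'.1 habs'.2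
    rw [h, Complex.zero_re] at this
    linarith
  exact kL_tr L q μ hz hz' h0 h1'

/-- the `2π`-translate DOWN in the coordinate `μ`. [folklore] -/
theorem tr_sub (q : Fin d → ℂ) (μ : Fin d) :
    tr (Function.update q μ (q μ - 2 * Real.pi)) μ = q := by
  rw [tr_def]
  simp only [Function.update_self, Function.update_idem, sub_add_cancel, Function.update_eq_self]

/-- **THE `2π` LAW NEAR THE RIGHT FACE**: for `q` with all `|Im q_ν| ≤ κ` (`κ ≤ 1`, `dκ² ≤ 1∕16`) and `π − 1∕4 ≤ Re q_μ ≤ π + 1∕4`: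
`k_L(q − 2πe_μ) = k_L(q)` — the other seam of a fold into `[−π, π)`. [folklore] -/
theorem kL_sub_two_pi_near_face (L : ℕ) [NeZero L] {κ : ℝ} (hκ : κ ≤ 1) (hdκ : (d : ℝ) * κ ^ 2 ≤ 1 / 16)
    {q : Fin d → ℂ} (hIm : ∀ ν, |(q ν).im| ≤ κ) (μ : Fin d)
    (h1 : Real.pi - 1 / 4 ≤ (q μ).re) (h2 : (q μ).re ≤ Real.pi + 1 / 4) :
    kL L (Function.update q μ (q μ - 2 * Real.pi)) = kL L q := by
  set q' := Function.update q μ (q μ - 2 * Real.pi) with hq'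
  have hIm' : ∀ ν, |(q' ν).im| ≤ κ := by
    intro ν
    by_cases h : ν = μ
    · subst h; rw [hq', Function.update_self]; simp; exact hIm ν
    · rw [hq', Function.update_of_ne h]; exact hIm ν
  have hre' : (q' μ).re = (q μ).re - 2 * Real.pi := by rw [hq', Function.update_self]; simp
  have h := kL_tr_near_face L hκ hdκ hIm' μ (by rw [hre']; linarith) (by rw [hre']; linarith)
  rw [hq', tr_sub] at h
  rw [hq']
  exact h.symm

end Summit.QuantumFields.BalabanUV.T4Continuum.NE7K1LinBlochSymbolSeam

end
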